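import Summits.AtomisticToContinuum.BoseEinsteinCondensation.Theorems.BECCutLineWeakDisorderWitnessTransferPairGeometry
import Summits.AtomisticToContinuum.BoseEinsteinCondensation.Theorems.BECCutLineWeakDisorderWitnessTransferWindowMass
import Summits.AtomisticToContinuum.BoseEinsteinCondensation.Theorems.BECCutLineWeakDisorderWitnessTransferConditioning
import Summits.AtomisticToContinuum.BoseEinsteinCondensation.Theorems.BECCutLineWeakDisorderWitnessTransferPairIndep
import Summits.AtomisticToContinuum.BoseEinsteinCondensation.Theorems.BECCutLineWeakDisorderWitnessTransferOccupationOneDim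
import Literature.Probability.RandomPlanarGeometry.BrownianExitPathLaw
import HarnessLib

/-!
# Route BECCutLineWeakDisorder — crux `WitnessTransfer`, line `Sketch`, stub (S6): path lifts and sections

Stub (S6) `stub_pairAction_ae_top_of_ne_zero` (a.s. infinite pair action from a hard relative
position `y ≠ 0`), first half: the key identity
`|Bⁱ_s − Bʲ_s| = √((|y| + 2U_s)² + 2|V'_s|²)` (unit-rate radial component `U`, transverse part
`V'`), independence of the path lifts `Φ_U`, `Φ_V` in `C([0,∞), ℝ)` resp. `C([0,∞), ℝ)³` (from
(S1) `stub_indepFun_pairRadial_pairTransverse`, σ-algebras generated by evaluations), the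
one-dimensional Paley–Zygmund estimate (S2) `stub_oneDim_occupation_pz` applied on every
transverse section with `2|γ_s|² ≤ r₀√t/2` (law of the path lift of `U` = pre-Brownian canonical
process), and the transverse good event of probability `≥ 1/2` for `t ≤ (r₀/1920)²`.
-/

noncomputable section

open MeasureTheory ProbabilityTheory Filter Set Metric
open scoped ENNReal NNReal Topology

namespace Summit.AtomisticToContinuum.BoseEinsteinCondensation.Theorems.CutLineWitness

open Literature.MathematicalPhysics.QuantumManyBody.BoseGas
open Literature.Probability.Process Literature.Probability.RandomPlanarGeometry
open scoped Literature.Probability.RandomPlanarGeometry.PathBorel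

/-! ### The radial coefficient vector and the key identity -/

/-- The unit-rate radial component `U_s = ∑_p c_p b_s(ω_p)` (radial coefficients of
`…CoreEntry`) is `(√2)⁻¹` times `U'_s = ∑_l (|y|⁻¹ y_l) d^l_s`. [folklore] -/
theorem radialComb_eq {N : ℕ} (i j : Fin N) {y : Space} (hy : y ≠ 0) (b : Fin N → Fin 3 → ℝ) :
    ∑ p : Fin N × Fin 3, (y p.2 / (Real.sqrt 2 * ‖y‖) *
      ((if p.1 = i then 1 else 0) - (if p.1 = j then 1 else 0))) * b p.1 p.2 =
      (Real.sqrt 2)⁻¹ * ∑ l, (‖y‖⁻¹ * y l) * (b i l - b j l) := by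
  rw [sum_radialCoeff_mul, Finset.mul_sum, Finset.sum_div]
  refine Finset.sum_congr rfl fun l _ => ?_
  have hn : ‖y‖ ≠ 0 := norm_ne_zero_iff.2 hy
  have hs : Real.sqrt 2 ≠ 0 := by positivity
  field_simp

/-- **Key identity**: the pair distance in terms of the unit-rate radial component and the
transverse square, `|Bⁱ_s − Bʲ_s| = √((|y| + 2U_s)² + 2∑_l (V'^l_s)²)` with
`U_s = ∑_p c_p b_s(ω_p)`, `V'^l_s = d^l_s − U'_s e_l`, `e = |y|⁻¹ y`. [folklore] -/
theorem dist_worldLine_eq_sqrt {N : ℕ} (X : Config N) (ω : PathSpace N) (s : ℝ≥0) {i j : Fin N}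
    (hy : X i - X j ≠ 0) :
    dist (worldLine X ω s i) (worldLine X ω s j) =
      Real.sqrt ((‖X i - X j‖ + 2 * ∑ p : Fin N × Fin 3, ((X i - X j) p.2 / (Real.sqrt 2 * ‖X i - X j‖) *
        ((if p.1 = i then 1 else 0) - (if p.1 = j then 1 else 0))) * brownian s (ω p.1 p.2)) ^ 2 +
        2 * ∑ l, ((brownian s (ω i l) - brownian s (ω j l)) -
          (∑ l', (‖X i - X j‖⁻¹ • (X i - X j)) l' * (brownian s (ω i l') - brownian s (ω j l'))) *
            (‖X i - X j‖⁻¹ • (X i - X j)) l) ^ 2) := by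
  set y := X i - X j with hy'
  rw [dist_worldLine_eq_norm, norm_add_sqrt_two_eq_sqrt hy,
    radialComb_eq i j hy (fun m l => brownian s (ω m l))]
  have hs : (2 : ℝ) * ((Real.sqrt 2)⁻¹ * ∑ l, (‖y‖⁻¹ * y l) * (brownian s (ω i l) - brownian s (ω j l))) =
      Real.sqrt 2 * ∑ l, (‖y‖⁻¹ * y l) * (brownian s (ω i l) - brownian s (ω j l)) := by
    rw [← mul_assoc, show (2 : ℝ) * (Real.sqrt 2)⁻¹ = Real.sqrt 2 from by
      rw [mul_inv_eq_iff_eq_mul₀ (by positivity)]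
      exact (Real.mul_self_sqrt (by norm_num : (0 : ℝ) ≤ 2)).symm]
  rw [hs]
  simp only [PiLp.smul_apply, smul_eq_mul]

/-! ### The path lifts of the radial and transverse processes -/

/-- **Independence of the path lifts.** The lift `Φ_U : ω ↦ (s ↦ U_s(ω)) ∈ C([0,∞),ℝ)` of the
unit-rate radial component and the lift `Φ_V : ω ↦ (l ↦ (s ↦ V'^l_s(ω)))` of the transverse part
are independent (their σ-algebras are generated by evaluations, which are measurable for the
radial, resp. transverse, families of (S1)). [folklore] -/
theorem indepFun_pathLift_radial_transverse {N : ℕ} {i j : Fin N} (hij : i ≠ j) {y : Space}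
    (hy : y ≠ 0)
    (hcU : ∀ ω : PathSpace N, Continuous fun s : ℝ≥0 => ∑ p : Fin N × Fin 3,
      (y p.2 / (Real.sqrt 2 * ‖y‖) * ((if p.1 = i then 1 else 0) - (if p.1 = j then 1 else 0))) *
        brownian s (ω p.1 p.2))
    (hcV : ∀ (l : Fin 3) (ω : PathSpace N), Continuous fun s : ℝ≥0 =>
      (brownian s (ω i l) - brownian s (ω j l)) -
        (∑ l', (‖y‖⁻¹ • y) l' * (brownian s (ω i l') - brownian s (ω j l'))) * (‖y‖⁻¹ • y) l) :
    IndepFun (toPathC (fun (s : ℝ≥0) (ω : PathSpace N) => ∑ p : Fin N × Fin 3,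
        (y p.2 / (Real.sqrt 2 * ‖y‖) * ((if p.1 = i then 1 else 0) - (if p.1 = j then 1 else 0))) *
          brownian s (ω p.1 p.2)) hcU)
      (fun (ω : PathSpace N) (l : Fin 3) => toPathC (fun (s : ℝ≥0) (ω : PathSpace N) =>
        (brownian s (ω i l) - brownian s (ω j l)) -
          (∑ l', (‖y‖⁻¹ • y) l' * (brownian s (ω i l') - brownian s (ω j l'))) * (‖y‖⁻¹ • y) l)
        (hcV l) ω)
      (wienerPaths N) := by
  set e : Space := ‖y‖⁻¹ • y with he
  have hen : ‖e‖ = 1 := by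
    rw [he, norm_smul, norm_inv, norm_norm, inv_mul_cancel₀ (norm_ne_zero_iff.2 hy)]
  have h1 := stub_indepFun_pairRadial_pairTransverse (N := N) hij e hen
  rw [IndepFun_iff_Indep] at h1 ⊢
  refine indep_of_indep_of_le_right (indep_of_indep_of_le_left h1 ?_) ?_
  · -- σ(Φ_U) ≤ σ(U')
    rw [comap_toPathC_eq]
    have hfun : (fun (ω : PathSpace N) (s : ℝ≥0) => ∑ p : Fin N × Fin 3,
        (y p.2 / (Real.sqrt 2 * ‖y‖) * ((if p.1 = i then 1 else 0) - (if p.1 = j then 1 else 0))) *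
          brownian s (ω p.1 p.2)) =
        (fun (f : ℝ≥0 → ℝ) (s : ℝ≥0) => (Real.sqrt 2)⁻¹ * f s) ∘
          fun (ω : PathSpace N) (s : ℝ≥0) => ∑ l, e l * (brownian s (ω i l) - brownian s (ω j l)) := by
      funext ω s
      simp only [Function.comp_apply]
      rw [radialComb_eq i j hy (fun m l => brownian s (ω m l))]
      simp only [he, PiLp.smul_apply, smul_eq_mul]
    rw [hfun, ← MeasurableSpace.comap_comp]
    exact MeasurableSpace.comap_mono ((measurable_pi_lambda _ fun s =>
      (measurable_pi_apply s).const_mul _).comap_le)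
  · -- σ(Φ_V) ≤ σ(V')
    have hpi : (MeasurableSpace.pi : MeasurableSpace (Fin 3 → C(ℝ≥0, ℝ))) =
        ⨆ l : Fin 3, MeasurableSpace.comap (fun F : Fin 3 → C(ℝ≥0, ℝ) => F l) inferInstance := rfl
    rw [hpi, MeasurableSpace.comap_iSup]
    refine iSup_le fun l => ?_
    rw [MeasurableSpace.comap_comp]
    change MeasurableSpace.comap (toPathC (fun (s : ℝ≥0) (ω : PathSpace N) =>
        (brownian s (ω i l) - brownian s (ω j l)) -
          (∑ l', e l' * (brownian s (ω i l') - brownian s (ω j l'))) * e l) (hcV l)) _ ≤ _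
    rw [comap_toPathC_eq]
    have hfun : (fun (ω : PathSpace N) (s : ℝ≥0) =>
        (brownian s (ω i l) - brownian s (ω j l)) -
          (∑ l', e l' * (brownian s (ω i l') - brownian s (ω j l'))) * e l) =
        (fun (F : Fin 3 × ℝ≥0 → ℝ) (s : ℝ≥0) => F (l, s)) ∘
          fun (ω : PathSpace N) (p : Fin 3 × ℝ≥0) =>
            (brownian p.2 (ω i p.1) - brownian p.2 (ω j p.1)) -
              (∑ l', e l' * (brownian p.2 (ω i l') - brownian p.2 (ω j l'))) * e p.1 := by
      funext ω s; rfl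
    rw [hfun, ← MeasurableSpace.comap_comp]
    exact MeasurableSpace.comap_mono ((measurable_pi_lambda _ fun s =>
      measurable_pi_apply (l, s)).comap_le)

/-! ### The one-dimensional estimate on the sections -/

/-- **Sections bound.** For a transverse path `γ` with `2|γ_s|² ≤ r₀√t/2` on `[0, t]`
(`√t ≤ r₀/8`) and a truncation level with window mass `M = ∫_W min(v, n+1) ∈ (0, ∞)`, the law of
the path lift of the unit-rate radial component gives the windowed occupation functional the
Paley–Zygmund bound of (S2): `P(∫₀ᵗ k(2|γ_s|², u_s) ds ≥ (√t/1000)(M/2)) ≥ 10⁻⁴`. [folklore] -/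
theorem map_radialLift_section_ge {N : ℕ} {v : ℝ → ℝ≥0∞} (hv : Measurable v) {i j : Fin N}
    (hij : i ≠ j) {y : Space} (hy : y ≠ 0) {t : ℝ} (ht : 0 < t) (htr : Real.sqrt t ≤ ‖y‖ / 8)
    (n : ℕ) (hM0 : ∫⁻ r in Ioo (‖y‖ - Real.sqrt t) (‖y‖ + Real.sqrt t), min (v r) ((n + 1 : ℕ) : ℝ≥0∞) ≠ 0)
    (hcU : ∀ ω : PathSpace N, Continuous fun s : ℝ≥0 => ∑ p : Fin N × Fin 3,
      (y p.2 / (Real.sqrt 2 * ‖y‖) * ((if p.1 = i then 1 else 0) - (if p.1 = j then 1 else 0))) *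
        brownian s (ω p.1 p.2))
    (γ : Fin 3 → C(ℝ≥0, ℝ)) (hγ : ∀ s ≤ t.toNNReal, 2 * ∑ l, (γ l s) ^ 2 ≤ ‖y‖ * Real.sqrt t / 2) :
    ENNReal.ofReal (1 / 10000) ≤ ((wienerPaths N).map (toPathC (fun (s : ℝ≥0) (ω : PathSpace N) =>
      ∑ p : Fin N × Fin 3, (y p.2 / (Real.sqrt 2 * ‖y‖) *
        ((if p.1 = i then 1 else 0) - (if p.1 = j then 1 else 0))) * brownian s (ω p.1 p.2)) hcU))
      {u : C(ℝ≥0, ℝ) | ENNReal.ofReal (Real.sqrt t / 1000) *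
        ((∫⁻ r in Ioo (‖y‖ - Real.sqrt t) (‖y‖ + Real.sqrt t), min (v r) ((n + 1 : ℕ) : ℝ≥0∞)) / 2) ≤
        ∫⁻ s in Ioc 0 t, indicator {u : ℝ | |u| ≤ 2 * Real.sqrt t} (fun u =>
          indicator (Ioo (‖y‖ - Real.sqrt t) (‖y‖ + Real.sqrt t)) (fun r => min (v r) ((n + 1 : ℕ) : ℝ≥0∞))
            (Real.sqrt ((‖y‖ + 2 * u) ^ 2 + 2 * ∑ l, (γ l (min s t).toNNReal) ^ 2))) (u s.toNNReal)} := by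
  haveI := Literature.Probability.RandomPlanarGeometry.isProbabilityMeasure_preWienerMeasure'
  haveI : IsProbabilityMeasure (wienerPaths N) := by unfold wienerPaths; infer_instance
  set r₀ := ‖y‖ with hr₀
  have hr₀pos : 0 < r₀ := norm_pos_iff.2 hy
  set st := Real.sqrt t with hst
  set M := ∫⁻ r in Ioo (r₀ - st) (r₀ + st), min (v r) ((n + 1 : ℕ) : ℝ≥0∞) with hM
  -- the radial coefficients are normalised
  have hc1 : ∑ p : Fin N × Fin 3, (y p.2 / (Real.sqrt 2 * ‖y‖) *
      ((if p.1 = i then 1 else 0) - (if p.1 = j then 1 else 0))) ^ 2 = 1 :=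
    sum_sq_radialCoeff hij hr₀pos
  have hU : IsPreBrownianReal (fun (s : ℝ≥0) (ω : PathSpace N) => ∑ p : Fin N × Fin 3,
      (y p.2 / (Real.sqrt 2 * ‖y‖) * ((if p.1 = i then 1 else 0) - (if p.1 = j then 1 else 0))) *
        brownian s (ω p.1 p.2)) (wienerPaths N) := isPreBrownianReal_coordComb _ hc1
  have hUm : ∀ s : ℝ≥0, Measurable fun ω : PathSpace N => ∑ p : Fin N × Fin 3,
      (y p.2 / (Real.sqrt 2 * ‖y‖) * ((if p.1 = i then 1 else 0) - (if p.1 = j then 1 else 0))) *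
        brownian s (ω p.1 p.2) := fun s => measurable_coordComb _ s
  -- the law of the path lift and the canonical process
  set P₁ := (wienerPaths N).map (toPathC (fun (s : ℝ≥0) (ω : PathSpace N) =>
      ∑ p : Fin N × Fin 3, (y p.2 / (Real.sqrt 2 * ‖y‖) *
        ((if p.1 = i then 1 else 0) - (if p.1 = j then 1 else 0))) * brownian s (ω p.1 p.2)) hcU) with hP₁
  haveI : IsProbabilityMeasure P₁ :=
    Measure.isProbabilityMeasure_map (measurable_toPathC hcU hUm).aemeasurable
  have hb : IsPreBrownianReal (fun t (u : C(ℝ≥0, ℝ)) => u t) P₁ :=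
    isPreBrownianReal_eval_map_toPathC hU hcU hUm
  -- the windowed integrand along `γ`
  set Q : ℝ → ℝ := fun s => 2 * ∑ l, (γ l (min s t).toNNReal) ^ 2 with hQ
  have hQc : Continuous Q := by
    refine continuous_const.mul (continuous_finsetSum _ fun l _ => ?_)
    exact ((γ l).continuous.comp (continuous_real_toNNReal.comp
      (continuous_id.min continuous_const))).pow 2
  have hQ0 : ∀ s, 0 ≤ Q s := fun s => by
    simp only [hQ]; positivity
  have hQb : ∀ s, Q s ≤ r₀ * st / 2 := fun s =>
    hγ _ (by
      show (min s t).toNNReal ≤ t.toNNReal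
      exact Real.toNNReal_le_toNNReal (min_le_right _ _))
  set k : ℝ → ℝ → ℝ≥0∞ := fun s u => indicator {u : ℝ | |u| ≤ 2 * st} (fun u =>
      indicator (Ioo (r₀ - st) (r₀ + st)) (fun r => min (v r) ((n + 1 : ℕ) : ℝ≥0∞))
        (Real.sqrt ((r₀ + 2 * u) ^ 2 + Q s))) u with hk
  have hkm : Measurable (Function.uncurry k) :=
    (measurable_windowIntegrand hv (n + 1) t r₀).comp (hQc.measurable.comp measurable_fst |>.prodMk measurable_snd)
  have hsupp : ∀ s u, k s u ≠ 0 → |u| ≤ 2 * Real.sqrt t := by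
    intro s u hsu
    by_contra hc
    exact hsu (by simp only [hk]; rw [indicator_of_notMem (by simpa using hc)])
  have hfib : ∀ s, M / 2 ≤ ∫⁻ u, k s u ∧ ∫⁻ u, k s u ≤ M := fun s =>
    lintegral_window_fibre v (n + 1) ht hr₀pos htr (hQ0 s) (hQb s)
  have hM2 : (2 : ℝ≥0∞) * (M / 2) = M := ENNReal.mul_div_cancel (by norm_num) (by norm_num)
  have h := stub_oneDim_occupation_pz (P := P₁) hb (fun t => measurable_pathC_eval t)
    (fun u => u.continuous) ht hkm (m := M / 2)
    (by simpa [ENNReal.div_eq_zero_iff] using hM0)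
    (ENNReal.div_ne_top (lintegral_min_natCast_Ioo_lt_top v (n + 1) _ _).ne (by norm_num))
    hsupp (fun s _ => (hfib s).1) (fun s _ => by rw [hM2]; exact (hfib s).2)
  exact h

/-! ### The transverse good event -/

/-- **The transverse good event has probability `≥ 1/2`.** For `0 < t ≤ (r₀/1920)²` and
`a = √(r₀√t/48)`, with probability `≥ 1/2` all six coordinates `b(ω m l)`, `m ∈ {i, j}`, have
running maximum `< a` up to time `t`. [folklore] -/
theorem measure_coords_small_ge_half {N : ℕ} (i j : Fin N) {r₀ t : ℝ} (hr₀ : 0 < r₀) (ht : 0 < t)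
    (htT : t ≤ (r₀ / 1920) ^ 2) :
    ENNReal.ofReal (1 / 2) ≤ wienerPaths N {ω | ∀ m ∈ ({i, j} : Finset (Fin N)), ∀ l : Fin 3,
      runSup t.toNNReal (ω m l) < Real.sqrt (r₀ * Real.sqrt t / 48)} := by
  haveI := Literature.Probability.RandomPlanarGeometry.isProbabilityMeasure_preWienerMeasure'
  haveI : IsProbabilityMeasure (wienerPaths N) := by unfold wienerPaths; infer_instance
  set st := Real.sqrt t with hst
  set a := Real.sqrt (r₀ * st / 48) with ha
  have hst0 : 0 < st := Real.sqrt_pos.2 ht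
  have ha0 : 0 ≤ a := Real.sqrt_nonneg _
  have ha2 : a ^ 2 = r₀ * st / 48 := Real.sq_sqrt (by positivity)
  have hstle : st ≤ r₀ / 1920 := by
    rw [hst, Real.sqrt_le_left (by positivity)]
    exact htT
  have htA : t ≤ (a / 2) ^ 2 / 10 := by
    have h1 : t = st * st := (Real.mul_self_sqrt ht.le).symm
    rw [h1, div_pow, ha2]
    nlinarith
  have hApos : 0 < (a / 2) ^ 2 := by rw [div_pow, ha2]; positivity
  have htA' : (t.toNNReal : ℝ) < (a / 2) ^ 2 := by
    rw [Real.coe_toNNReal _ ht.le]; linarith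
  -- the bad event
  have hbad := measure_exists_runSup_ge_le (N := N) i j t.toNNReal ha0 htA'
  rw [Real.coe_toNNReal _ ht.le] at hbad
  have hnum : 6 * ENNReal.ofReal (2 * t ^ 2 / ((a / 2) ^ 2 - t) ^ 2) ≤ ENNReal.ofReal (1 / 2) := by
    rw [← ENNReal.ofReal_ofNat 6, ← ENNReal.ofReal_mul (by norm_num)]
    refine ENNReal.ofReal_le_ofReal ?_
    rw [mul_div_assoc', div_le_iff₀ (by nlinarith)]
    nlinarith
  have hmeas : MeasurableSet {ω : PathSpace N | ∃ m ∈ ({i, j} : Finset (Fin N)), ∃ l : Fin 3,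
      a ≤ runSup t.toNNReal (ω m l)} := by
    have hset : {ω : PathSpace N | ∃ m ∈ ({i, j} : Finset (Fin N)), ∃ l : Fin 3,
        a ≤ runSup t.toNNReal (ω m l)} = ⋃ m ∈ ({i, j} : Finset (Fin N)), ⋃ l : Fin 3,
          {ω : PathSpace N | a ≤ runSup t.toNNReal (ω m l)} := by
      ext ω; simp
    rw [hset]
    refine MeasurableSet.biUnion (Finset.countable_toSet _) fun m _ => MeasurableSet.iUnion fun l => ?_
    exact measurableSet_le measurable_const ((measurable_runSup _).comp
      ((measurable_pi_apply l).comp (measurable_pi_apply m)))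
  have hcompl : {ω : PathSpace N | ∀ m ∈ ({i, j} : Finset (Fin N)), ∀ l : Fin 3,
      runSup t.toNNReal (ω m l) < a} =
      {ω : PathSpace N | ∃ m ∈ ({i, j} : Finset (Fin N)), ∃ l : Fin 3, a ≤ runSup t.toNNReal (ω m l)}ᶜ := by
    ext ω; simp [not_le]
  rw [hcompl, prob_compl_eq_one_sub hmeas]
  have h1 : wienerPaths N {ω : PathSpace N | ∃ m ∈ ({i, j} : Finset (Fin N)), ∃ l : Fin 3,
      a ≤ runSup t.toNNReal (ω m l)} ≤ ENNReal.ofReal (1 / 2) := hbad.trans hnum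
  calc ENNReal.ofReal (1 / 2) = 1 - ENNReal.ofReal (1 / 2) := by
        rw [← ENNReal.ofReal_one, ← ENNReal.ofReal_sub _ (by norm_num)]; norm_num
    _ ≤ 1 - wienerPaths N {ω : PathSpace N | ∃ m ∈ ({i, j} : Finset (Fin N)), ∃ l : Fin 3,
        a ≤ runSup t.toNNReal (ω m l)} := tsub_le_tsub_left h1 _

end Summit.AtomisticToContinuum.BoseEinsteinCondensation.Theorems.CutLineWitness

end
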